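import Literature.Analysis.SpecialFunctions.HurwitzZetaRationalEnclosure
import Summits.RiemannHypothesis.RiemannHypothesis.Theorems.WeilFormatCPolyWindowConstantsBox
import HarnessLib

/-!
# Format C, design C∞ (E2c, data side): kernel boxes for the PURE-POWER family-Gram tails `Σ_{m≥m₀} 1/m^s`

Route context: Fourier–Galerkin / Schur-complement certificates of Weil positivity on a window ("format C", C∞ door;
cell memo `run/shared/lean/pub/rh-explicit/rh-explicit-weil-2/gen15/E2-PLAN-v2.md` §5.5 (E2c); supporting stmt-RiemannHypothesis-0098;
seat rh-explicit-weil-2).  The family Gram of the C∞ door over the (tag, power) families `T_t(m)/m^d` is Hankel in the power: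
its `(1,1)`-tag entries are the tails `H(s) = Σ_{m≥m₀} m^{−s} = Σ_{k≥0} (k+m₀)^{−s}`, `s = d + d' ≥ 2`.  This file turns the rational
Euler–Maclaurin enclosure `abs_tsum_inv_pow_sub_hurwitzNatMain_le` (`HurwitzZetaRationalEnclosure`, `c := m₀`) into a
fixed-point box: `CinfCoeff.pureTailBox`, `mem_pureTailBox`.  Interval plumbing only; standard axioms; no RH claim.
-/

set_option autoImplicit false
-- `Summit.RiemannHypothesis.RiemannHypothesis.…` is the layout-mandated namespace (summit = problem name).
set_option linter.dupNamespace false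

namespace Summit.RiemannHypothesis.RiemannHypothesis.Theorems.WeilFormatC

open Literature.Analysis.SpecialFunctions
open Literature.Analysis.ValidatedNumerics Literature.Analysis.ValidatedNumerics.NumericsMP

namespace CinfCoeff

open WinConst (ratBox mem_ratBox)

variable {S : ℕ}

/-- **Pure-power tail box**: `[main − tail, main + tail]` of the Euler–Maclaurin enclosure with shift `J`, order `ν`,
rounded outward to scale `S`. -/
def pureTailBox (S : ℕ) (m₀ s J ν : ℕ) : MI :=
  ⟨(ratBox S (hurwitzNatMain (m₀ : ℚ) J ν s - hurwitzNatTail (m₀ : ℚ) J ν s)).lo,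
   (ratBox S (hurwitzNatMain (m₀ : ℚ) J ν s + hurwitzNatTail (m₀ : ℚ) J ν s)).hi⟩

/-- **`pureTailBox ∋ Σ_{k≥0} (k+m₀)^{−s}`** (`m₀ ≥ 1`, `s ≥ 2`, `ν ≥ 1`). -/
theorem mem_pureTailBox {m₀ s : ℕ} (hm₀ : 0 < m₀) (hs : 2 ≤ s) (J : ℕ) {ν : ℕ} (hν : ν ≠ 0) :
    MI.mem S (∑' k : ℕ, (((k : ℝ) + ((m₀ : ℚ) : ℝ)) ^ s)⁻¹) (pureTailBox S m₀ s J ν) := by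
  have hc : (0 : ℚ) < (m₀ : ℚ) := by exact_mod_cast hm₀
  obtain ⟨-, habs⟩ := abs_tsum_inv_pow_sub_hurwitzNatMain_le hc hs J hν
  obtain ⟨h1, h2⟩ := abs_le.1 habs
  push_cast at h1 h2
  have hlo := (mem_ratBox S (hurwitzNatMain (m₀ : ℚ) J ν s - hurwitzNatTail (m₀ : ℚ) J ν s)).1
  have hhi := (mem_ratBox S (hurwitzNatMain (m₀ : ℚ) J ν s + hurwitzNatTail (m₀ : ℚ) J ν s)).2
  have hSn : (0 : ℝ) ≤ (S : ℝ) := by positivity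
  unfold pureTailBox
  constructor
  · refine hlo.trans ?_
    push_cast
    exact mul_le_mul_of_nonneg_right (by linarith) hSn
  · refine le_trans ?_ hhi
    push_cast
    exact mul_le_mul_of_nonneg_right (by linarith) hSn

/-- The same tail written over the natural modes `m ≥ m₀`: `Σ_{k≥0} ((m₀+k : ℕ))^{−s} ∈ pureTailBox`. -/
theorem mem_pureTailBox_nat {m₀ s : ℕ} (hm₀ : 0 < m₀) (hs : 2 ≤ s) (J : ℕ) {ν : ℕ} (hν : ν ≠ 0) :
    MI.mem S (∑' k : ℕ, 1 / (((m₀ + k : ℕ)) : ℝ) ^ s) (pureTailBox S m₀ s J ν) := by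
  have h := mem_pureTailBox (S := S) hm₀ hs J hν
  have e : (fun k : ℕ ↦ 1 / (((m₀ + k : ℕ)) : ℝ) ^ s) = fun k : ℕ ↦ (((k : ℝ) + ((m₀ : ℚ) : ℝ)) ^ s)⁻¹ := by
    funext k; push_cast; rw [one_div, add_comm]
  rw [e]; exact h

/-- **Rescaled pure-power tail box** `m₀^s·Σ_{k≥0} (k+m₀)^{−s}` (the `(1,1)`-tag Gram entry of the RESCALED families
`(m₀/m)^d`, an `O(m₀/(s−1))` number): exact rational rescaling before rounding. -/
def pureTailScaledBox (S : ℕ) (m₀ s J ν : ℕ) : MI :=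
  ⟨(ratBox S ((m₀ : ℚ) ^ s * (hurwitzNatMain (m₀ : ℚ) J ν s - hurwitzNatTail (m₀ : ℚ) J ν s))).lo,
   (ratBox S ((m₀ : ℚ) ^ s * (hurwitzNatMain (m₀ : ℚ) J ν s + hurwitzNatTail (m₀ : ℚ) J ν s))).hi⟩

/-- **`pureTailScaledBox ∋ m₀^s·Σ_{k≥0} (k+m₀)^{−s}`** (`m₀ ≥ 1`, `s ≥ 2`, `ν ≥ 1`). -/
theorem mem_pureTailScaledBox {m₀ s : ℕ} (hm₀ : 0 < m₀) (hs : 2 ≤ s) (J : ℕ) {ν : ℕ} (hν : ν ≠ 0) :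
    MI.mem S (((m₀ : ℚ) : ℝ) ^ s * ∑' k : ℕ, (((k : ℝ) + ((m₀ : ℚ) : ℝ)) ^ s)⁻¹) (pureTailScaledBox S m₀ s J ν) := by
  have hc : (0 : ℚ) < (m₀ : ℚ) := by exact_mod_cast hm₀
  obtain ⟨-, habs⟩ := abs_tsum_inv_pow_sub_hurwitzNatMain_le hc hs J hν
  obtain ⟨h1, h2⟩ := abs_le.1 habs
  push_cast at h1 h2
  have hlo := (mem_ratBox S ((m₀ : ℚ) ^ s * (hurwitzNatMain (m₀ : ℚ) J ν s - hurwitzNatTail (m₀ : ℚ) J ν s))).1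
  have hhi := (mem_ratBox S ((m₀ : ℚ) ^ s * (hurwitzNatMain (m₀ : ℚ) J ν s + hurwitzNatTail (m₀ : ℚ) J ν s))).2
  have hSn : (0 : ℝ) ≤ (S : ℝ) := by positivity
  have hp : (0 : ℝ) ≤ (m₀ : ℝ) ^ s := by positivity
  unfold pureTailScaledBox
  constructor
  · refine hlo.trans ?_
    push_cast
    exact mul_le_mul_of_nonneg_right (mul_le_mul_of_nonneg_left (by linarith) hp) hSn
  · refine le_trans ?_ hhi
    push_cast
    exact mul_le_mul_of_nonneg_right (mul_le_mul_of_nonneg_left (by linarith) hp) hSn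

end CinfCoeff

end Summit.RiemannHypothesis.RiemannHypothesis.Theorems.WeilFormatC
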